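import Literature.Claims.NS.LucardoOlivaes2026
import Literature.Analysis.FluidPDE.VorticityCalculus
import Literature.Analysis.FluidPDE.VectorCalculusProofs
import Literature.Analysis.FluidPDE.IsometryInvariance
import Literature.Analysis.FluidPDE.NSLerayHopfSereginEnergyProofs
import Literature.Analysis.FluidPDE.TaoLocalisation
import Summits.NavierStokesRegularity.NavierStokesRegularity.Theorems.SoloRefuteBledsoe2026Stretching
import HarnessLib

/-!
# C137 `LucardoOlivaes2026` (cell `ns-claims`, D-0090) — kernel NON-VACUITY GUARD for the token of record,
# part 1/3: the mirror isometry and the cut-off cavity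

Claim C137: skeleton `Literature.Claims.NS.LucardoOlivaes2026` (typist-10 g4; rev 4 p513667). ADJUDICATED #120
(chair, 2026-08-27T08:29:10Z) located the first failing step at `Step6GI_StretchLower` (§4.1 display (6), p.2
l.44–54, read over the printed geometric class of §3 p.2 l.12–26 with the INTEGRAL alignment `0 < ∫ ωᵀSω`),
class unfilled gap, and recorded that the class `Step3GI_Datum` was «inhabited on paper only … OPEN in the tree
= the non-vacuity guard the VERDICT presupposes» (REF F6). The three files
`SoloSalvageLucardoOlivaes2026GICavity` → `SoloSalvageLucardoOlivaes2026GIBlob` → `SoloSalvageLucardoOlivaes2026GI`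
construct an explicit member and prove `step3GI_Datum_holds : Step3GI_Datum` (file 3), which is at the same time
the D-0026 discharge of that named statement (chair RULINGS 2026-08-27T08:48Z (2): second refuter
`ns-claims-refuter-3` g3 builds, salvage seat `ns-claims-salvage-p4` g3 files unchanged, referee
`ns-claims-ref-1` g4 reads back). Source: J. R. Lucardo Olivaes, Zenodo 10.5281/zenodo.21815761 (2026), 3 pp.

This file: coordinates on `E3`; the mirror `R = mirrorZ`, `(x₀,x₁,x₂) ↦ (x₀,x₁,−x₂)`, as a linear isometry
equivalence `Ri`; the radial plateau cut-off `φC y = h(‖y‖²)` (`h = smoothTransition (2 − ·)`: `= 1` on the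
unit ball, `= 0` off the ball of radius `√2`); the SHIFTED EXPANSIVE STRAIN `Dsh y = (y₀, y₁, −2(y₂+2))` with
vector potential `Ad y = (y₂+2)·(y₁, −y₀, 0)` (`curl Ad = Dsh`, `curl Dsh = 0`); and the CAVITY
`C = curl (φC • Ad)`: smooth, compactly supported, divergence free, `= Dsh` on the unit ball, `= 0` off radius
`√2`, swirl-free (`⟪C y, e_θ(y)⟫ = 0`), with axis values `C(0,0,ζ)₂ = −2 h(ζ²)(ζ+2)`. Tree tools reused:
`curl_smul`, `contDiff_curl`, `hasCompactSupport_curl`, `divergence_curl_eq_zero_holds` (`VorticityCalculus`,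
`VectorCalculusProofs`) and the C86 field kit `SoloRefuteBledsoe2026Fields` (`Dlin`, `curl_Dlin`,
`inner_Dlin_of_horizontal`, `hasFDerivAt_radial`, `contDiff_coord`, `fderiv_apply_coord`).

WHAT THIS IS NOT: not a claim about NS regularity or blow-up; not a claim about any author beyond the typed
locator.
-/

-- The summit's canonical theorem namespace repeats the summit name (single-conjunct summit).
set_option linter.dupNamespace false

noncomputable section

open Set MeasureTheory Filter Topology Function Metric
open scoped RealInnerProductSpace ContDiff

namespace Summit.NavierStokesRegularity.NavierStokesRegularity.Theorems.LucardoOlivaes2026GI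

open Literature.Analysis.FluidPDE
open Literature.Claims.NS.LucardoOlivaes2026
open Literature.Claims.NS.Chae2007 (IsDatum)
open Summit.NavierStokesRegularity.NavierStokesRegularity.Theorems.Bledsoe2026 (w x₀ w_contDiff
  w_differentiable w_hasCompactSupport divergence_w curl_w_x₀_ne_zero curl_w_eq_zero w_eq_zero
  fderiv_w_eq_zero w_apply_zero w_apply_one w_apply_two curl_w_apply_two G G_eq_zero Dlin Dlin_apply
  curl_Dlin inner_Dlin_of_horizontal contDiff_coord hasFDerivAt_radial)

/-! ### Coordinates -/

/-- kit lemma (plumbing) [folklore] -/ theorem hasFDerivAt_coord (i : Fin 3) (x : E3) :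
    HasFDerivAt (fun y : E3 => y i) (EuclideanSpace.proj i : E3 →L[ℝ] ℝ) x :=
  (EuclideanSpace.proj i : E3 →L[ℝ] ℝ).hasFDerivAt

/-- kit lemma (plumbing) [folklore] -/ theorem normsq_eq (x : E3) : ‖x‖ ^ 2 = x 0 ^ 2 + x 1 ^ 2 + x 2 ^ 2 := by
  rw [EuclideanSpace.real_norm_sq_eq, Fin.sum_univ_three]

/-- kit lemma (plumbing) [folklore] -/ theorem inner_eq3 (a b : E3) : ⟪a, b⟫ = a 0 * b 0 + a 1 * b 1 + a 2 * b 2 := by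
  rw [PiLp.inner_apply, Fin.sum_univ_three]; simp [mul_comm]

/-- kit lemma (plumbing) [folklore] -/ theorem sq_apply_two_le_normsq (x : E3) : x 2 ^ 2 ≤ ‖x‖ ^ 2 := by
  rw [normsq_eq]; nlinarith [sq_nonneg (x 0), sq_nonneg (x 1)]

/-! ### The mirror `R = mirrorZ` as a linear isometry -/

/-- kit lemma (plumbing) [folklore] -/ @[simp] theorem mirrorZ_apply_zero (x : E3) : mirrorZ x 0 = x 0 := by simp [mirrorZ]
/-- kit lemma (plumbing) [folklore] -/ @[simp] theorem mirrorZ_apply_one (x : E3) : mirrorZ x 1 = x 1 := by simp [mirrorZ]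
/-- kit lemma (plumbing) [folklore] -/ @[simp] theorem mirrorZ_apply_two (x : E3) : mirrorZ x 2 = -x 2 := by simp [mirrorZ]

/-- kit lemma (plumbing) [folklore] -/ @[simp] theorem mirrorZ_mirrorZ (x : E3) : mirrorZ (mirrorZ x) = x := by
  ext i; fin_cases i <;> simp

/-- kit lemma (plumbing) [folklore] -/ theorem mirrorZ_add (x y : E3) : mirrorZ (x + y) = mirrorZ x + mirrorZ y := by
  ext i; fin_cases i <;> simp [add_comm]

/-- kit lemma (plumbing) [folklore] -/ theorem mirrorZ_smul (r : ℝ) (x : E3) : mirrorZ (r • x) = r • mirrorZ x := by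
  ext i; fin_cases i <;> simp

/-- kit lemma (plumbing) [folklore] -/ theorem mirrorZ_sub (x y : E3) : mirrorZ (x - y) = mirrorZ x - mirrorZ y := by
  ext i; fin_cases i <;> simp [sub_eq_add_neg, add_comm]

/-- kit lemma (plumbing) [folklore] -/ @[simp] theorem mirrorZ_zero : mirrorZ (0 : E3) = 0 := by
  ext i; fin_cases i <;> simp

/-- kit lemma (plumbing) [folklore] -/ theorem inner_mirrorZ_mirrorZ (x y : E3) : ⟪mirrorZ x, mirrorZ y⟫ = ⟪x, y⟫ := by
  rw [inner_eq3, inner_eq3]; simp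

/-- kit lemma (plumbing) [folklore] -/ theorem norm_mirrorZ (x : E3) : ‖mirrorZ x‖ = ‖x‖ := by
  have h : ‖mirrorZ x‖ ^ 2 = ‖x‖ ^ 2 := by rw [normsq_eq, normsq_eq]; simp
  nlinarith [norm_nonneg (mirrorZ x), norm_nonneg x, sq_nonneg (‖mirrorZ x‖ - ‖x‖),
    sq_nonneg (‖mirrorZ x‖ + ‖x‖)]

/-- `mirrorZ` as a linear equivalence. -/
def RiLin : E3 ≃ₗ[ℝ] E3 where
  toFun := mirrorZ
  invFun := mirrorZ
  map_add' := mirrorZ_add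
  map_smul' := mirrorZ_smul
  left_inv := mirrorZ_mirrorZ
  right_inv := mirrorZ_mirrorZ

/-- `mirrorZ` as a linear isometry equivalence. -/
def Ri : E3 ≃ₗᵢ[ℝ] E3 := RiLin.isometryOfInner inner_mirrorZ_mirrorZ

/-- kit lemma (plumbing) [folklore] -/ @[simp] theorem Ri_apply (x : E3) : Ri x = mirrorZ x := rfl
/-- kit lemma (plumbing) [folklore] -/ @[simp] theorem Ri_symm_apply (x : E3) : Ri.symm x = mirrorZ x := rfl

/-- kit lemma (plumbing) [folklore] -/ theorem Ri_toCLM_apply (x : E3) : (Ri : E3 →L[ℝ] E3) x = mirrorZ x := rfl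

/-! ### The cut-off profile `h(s) = smoothTransition (2 − s)` -/

/-- `hC s = 1` for `s ≤ 1`, `hC s = 0` for `s ≥ 2`, smooth, values in `[0,1]`. -/
def hC (s : ℝ) : ℝ := Real.smoothTransition (2 - s)

/-- kit lemma (plumbing) [folklore] -/ theorem hC_contDiff : ContDiff ℝ ∞ hC :=
  Real.smoothTransition.contDiff.comp (contDiff_const.sub contDiff_id)

/-- kit lemma (plumbing) [folklore] -/ theorem hC_differentiable : Differentiable ℝ hC := hC_contDiff.differentiable (by simp)

/-- kit lemma (plumbing) [folklore] -/ theorem hC_eq_one {s : ℝ} (hs : s ≤ 1) : hC s = 1 :=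
  Real.smoothTransition.one_of_one_le (by linarith)

/-- kit lemma (plumbing) [folklore] -/ theorem hC_eq_zero {s : ℝ} (hs : 2 ≤ s) : hC s = 0 :=
  Real.smoothTransition.zero_of_nonpos (by linarith)

/-- kit lemma (plumbing) [folklore] -/ theorem hC_pos {s : ℝ} (hs : s < 2) : 0 < hC s :=
  Real.smoothTransition.pos_of_pos (by linarith)

/-- kit lemma (plumbing) [folklore] -/ theorem hC_nonneg (s : ℝ) : 0 ≤ hC s := Real.smoothTransition.nonneg _

/-- The radial cut-off `y ↦ hC (‖y‖²)`. -/
def φC (y : E3) : ℝ := hC (‖y‖ ^ 2)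

/-- kit lemma (plumbing) [folklore] -/ theorem φC_contDiff : ContDiff ℝ ∞ φC := hC_contDiff.comp (contDiff_norm_sq ℝ)

/-- kit lemma (plumbing) [folklore] -/ theorem φC_differentiable : Differentiable ℝ φC := φC_contDiff.differentiable (by simp)

/-- kit lemma (plumbing) [folklore] -/ theorem hasFDerivAt_φC (y : E3) :
    HasFDerivAt φC (deriv hC (‖y‖ ^ 2) • ((2 : ℕ) • innerSL ℝ y)) y :=
  hasFDerivAt_radial (hC_differentiable _).hasDerivAt

/-- kit lemma (plumbing) [folklore] -/ theorem φC_eq_one_of {y : E3} (hy : ‖y‖ ^ 2 ≤ 1) : φC y = 1 := hC_eq_one hy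
/-- kit lemma (plumbing) [folklore] -/ theorem φC_eq_zero_of {y : E3} (hy : 2 ≤ ‖y‖ ^ 2) : φC y = 0 := hC_eq_zero hy

/-! ### The shifted strain potential `Ad` and its curl `Dsh` -/

/-- Vector potential of the shifted strain: `Ad y = (y₂ + 2) · (y₁, −y₀, 0)`. -/
def Ad (y : E3) : E3 := WithLp.toLp 2 ![(y 2 + 2) * y 1, -((y 2 + 2) * y 0), 0]

/-- kit lemma (plumbing) [folklore] -/ theorem Ad_apply_zero (y : E3) : Ad y 0 = (y 2 + 2) * y 1 := by simp [Ad]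
/-- kit lemma (plumbing) [folklore] -/ theorem Ad_apply_one (y : E3) : Ad y 1 = -((y 2 + 2) * y 0) := by simp [Ad]
/-- kit lemma (plumbing) [folklore] -/ theorem Ad_apply_two (y : E3) : Ad y 2 = 0 := by simp [Ad]

/-- kit lemma (plumbing) [folklore] -/ theorem Ad_contDiff : ContDiff ℝ ∞ Ad := by
  rw [contDiff_piLp]
  intro i
  fin_cases i
  · exact ((contDiff_coord 2).add contDiff_const).mul (contDiff_coord 1)
  · exact (((contDiff_coord 2).add contDiff_const).mul (contDiff_coord 0)).neg
  · exact contDiff_const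

/-- kit lemma (plumbing) [folklore] -/ theorem Ad_differentiable : Differentiable ℝ Ad := Ad_contDiff.differentiable (by simp)

/-- kit lemma (plumbing) [folklore] -/ theorem hasFDerivAt_Ad0 (y : E3) : HasFDerivAt (fun z => Ad z 0)
    ((y 2 + 2) • (EuclideanSpace.proj 1 : E3 →L[ℝ] ℝ) + y 1 • (EuclideanSpace.proj 2 : E3 →L[ℝ] ℝ)) y := by
  have h := ((hasFDerivAt_coord 2 y).add_const 2).mul (hasFDerivAt_coord 1 y)
  refine (h.congr_of_eventuallyEq (Eventually.of_forall fun z => Ad_apply_zero z)).congr_fderiv ?_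
  ext v; simp

/-- kit lemma (plumbing) [folklore] -/ theorem hasFDerivAt_Ad1 (y : E3) : HasFDerivAt (fun z => Ad z 1)
    (-((y 2 + 2) • (EuclideanSpace.proj 0 : E3 →L[ℝ] ℝ) + y 0 • (EuclideanSpace.proj 2 : E3 →L[ℝ] ℝ))) y := by
  have h := (((hasFDerivAt_coord 2 y).add_const 2).mul (hasFDerivAt_coord 0 y)).neg
  refine (h.congr_of_eventuallyEq (Eventually.of_forall fun z => Ad_apply_one z)).congr_fderiv ?_
  ext v; simp

/-- kit lemma (plumbing) [folklore] -/ theorem hasFDerivAt_Ad2 (y : E3) : HasFDerivAt (fun z => Ad z 2) (0 : E3 →L[ℝ] ℝ) y :=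
  (hasFDerivAt_const (0 : ℝ) y).congr_of_eventuallyEq (Eventually.of_forall fun z => Ad_apply_two z)

/-- The shifted expansive strain `Dsh y = (y₀, y₁, −2(y₂ + 2))`. -/
def Dsh (y : E3) : E3 := WithLp.toLp 2 ![y 0, y 1, -2 * (y 2 + 2)]

/-- kit lemma (plumbing) [folklore] -/ @[simp] theorem Dsh_apply_zero (y : E3) : Dsh y 0 = y 0 := by simp [Dsh]
/-- kit lemma (plumbing) [folklore] -/ @[simp] theorem Dsh_apply_one (y : E3) : Dsh y 1 = y 1 := by simp [Dsh]
/-- kit lemma (plumbing) [folklore] -/ @[simp] theorem Dsh_apply_two (y : E3) : Dsh y 2 = -2 * (y 2 + 2) := by simp [Dsh]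

/-- The constant shift `k = (0,0,−4)`. -/
def kvec : E3 := WithLp.toLp 2 ![0, 0, -4]

/-- kit lemma (plumbing) [folklore] -/ theorem Dsh_eq (y : E3) : Dsh y = Dlin y + kvec := by
  ext i; fin_cases i <;> simp [Dlin_apply, kvec]; ring

/-- `curl Ad = Dsh`. -/
theorem curl_Ad (y : E3) : curl Ad y = Dsh y := by
  ext k
  fin_cases k
  · simp [curl, Bledsoe2026.fderiv_apply_coord (Ad_differentiable y), (hasFDerivAt_Ad1 y).fderiv,
      (hasFDerivAt_Ad2 y).fderiv]
  · simp [curl, Bledsoe2026.fderiv_apply_coord (Ad_differentiable y), (hasFDerivAt_Ad0 y).fderiv,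
      (hasFDerivAt_Ad2 y).fderiv]
  · simp [curl, Bledsoe2026.fderiv_apply_coord (Ad_differentiable y), (hasFDerivAt_Ad0 y).fderiv,
      (hasFDerivAt_Ad1 y).fderiv]
    ring

/-- kit lemma (plumbing) [folklore] -/ theorem fderiv_Dsh (y : E3) : fderiv ℝ Dsh y = Dlin := by
  have h : Dsh = fun z => Dlin z + kvec := funext Dsh_eq
  rw [h, fderiv_add_const]; exact Dlin.fderiv

/-- kit lemma (plumbing) [folklore] -/ theorem Dsh_differentiable : Differentiable ℝ Dsh := by
  have h : Dsh = fun z => Dlin z + kvec := funext Dsh_eq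
  rw [h]; exact (Dlin.differentiable).add_const _

/-- kit lemma (plumbing) [folklore] -/ theorem curl_Dsh (y : E3) : curl Dsh y = 0 := by
  rw [curl_eq_curlCLM, fderiv_Dsh, ← Dlin.fderiv (x := y), ← curl_eq_curlCLM]; exact curl_Dlin y

/-! ### The cavity `C = curl (φC • Ad)` -/

/-- The compactly supported potential. -/
def Ψ (y : E3) : E3 := φC y • Ad y

/-- The cavity field. -/
def C : E3 → E3 := curl Ψ

/-- kit lemma (plumbing) [folklore] -/ theorem Ψ_contDiff : ContDiff ℝ ∞ Ψ := φC_contDiff.smul Ad_contDiff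

/-- kit lemma (plumbing) [folklore] -/ theorem Ψ_eq_zero {y : E3} (hy : 2 ≤ ‖y‖ ^ 2) : Ψ y = 0 := by
  simp [Ψ, φC_eq_zero_of hy]

/-- kit lemma (plumbing) [folklore] -/ theorem Ψ_hasCompactSupport : HasCompactSupport Ψ := by
  refine HasCompactSupport.intro (isCompact_closedBall (0 : E3) 2) fun y hy => Ψ_eq_zero ?_
  have h1 : 2 < ‖y‖ := by simpa [mem_closedBall, dist_zero_right] using hy
  nlinarith

/-- kit lemma (plumbing) [folklore] -/ theorem C_contDiff : ContDiff ℝ ∞ C :=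
  contDiff_curl (n := ⊤) (Ψ_contDiff.of_le (by exact_mod_cast le_top))

/-- kit lemma (plumbing) [folklore] -/ theorem C_differentiable : Differentiable ℝ C := C_contDiff.differentiable (by simp)

/-- kit lemma (plumbing) [folklore] -/ theorem C_hasCompactSupport : HasCompactSupport C := hasCompactSupport_curl Ψ_hasCompactSupport

/-- kit lemma (plumbing) [folklore] -/ theorem divergence_C (y : E3) : VectorCalculus.divergence C y = 0 :=
  divergence_curl_eq_zero_holds Ψ (contDiff_infty.1 Ψ_contDiff 2) y

/-- On the open unit ball `Ψ = Ad` near every point, so `C = Dsh` there. -/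
theorem C_eq_Dsh {y : E3} (hy : ‖y‖ ^ 2 < 1) : C y = Dsh y := by
  have hopen : IsOpen {z : E3 | ‖z‖ ^ 2 < 1} := isOpen_lt (continuous_norm.pow 2) continuous_const
  have h : Ψ =ᶠ[𝓝 y] Ad := by
    filter_upwards [hopen.mem_nhds hy] with z hz
    rw [Ψ, φC_eq_one_of (le_of_lt hz), one_smul]
  show curl Ψ y = Dsh y
  rw [curl_eq_curlCLM, h.fderiv_eq, ← curl_eq_curlCLM, curl_Ad]

/-- kit lemma (plumbing) [folklore] -/ theorem C_eventuallyEq {y : E3} (hy : ‖y‖ ^ 2 < 1) : C =ᶠ[𝓝 y] Dsh := by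
  have hopen : IsOpen {z : E3 | ‖z‖ ^ 2 < 1} := isOpen_lt (continuous_norm.pow 2) continuous_const
  filter_upwards [hopen.mem_nhds hy] with z hz using C_eq_Dsh hz

/-- kit lemma (plumbing) [folklore] -/ theorem fderiv_C {y : E3} (hy : ‖y‖ ^ 2 < 1) : fderiv ℝ C y = Dlin := by
  rw [(C_eventuallyEq hy).fderiv_eq]; exact fderiv_Dsh y

/-- kit lemma (plumbing) [folklore] -/ theorem curl_C_of_lt_one {y : E3} (hy : ‖y‖ ^ 2 < 1) : curl C y = 0 := by
  rw [curl_eq_curlCLM, (C_eventuallyEq hy).fderiv_eq, ← curl_eq_curlCLM]; exact curl_Dsh y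

/-- Off the ball of radius `√2`, `Ψ = 0` near every point, so `C = 0` there with all derivatives. -/
theorem C_eventuallyEq_zero {y : E3} (hy : 2 < ‖y‖ ^ 2) : C =ᶠ[𝓝 y] fun _ => 0 := by
  have hopen : IsOpen {z : E3 | 2 < ‖z‖ ^ 2} := isOpen_lt continuous_const (continuous_norm.pow 2)
  filter_upwards [hopen.mem_nhds hy] with z hz
  have h : Ψ =ᶠ[𝓝 z] fun _ => 0 := by
    filter_upwards [hopen.mem_nhds hz] with u hu using Ψ_eq_zero (le_of_lt hu)
  show curl Ψ z = 0
  rw [curl_eq_curlCLM, h.fderiv_eq, ← curl_eq_curlCLM]; exact curl_fun_zero z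

/-- kit lemma (plumbing) [folklore] -/ theorem C_eq_zero {y : E3} (hy : 2 < ‖y‖ ^ 2) : C y = 0 := (C_eventuallyEq_zero hy).self_of_nhds

/-- kit lemma (plumbing) [folklore] -/ theorem fderiv_C_eq_zero {y : E3} (hy : 2 < ‖y‖ ^ 2) : fderiv ℝ C y = 0 := by
  rw [(C_eventuallyEq_zero hy).fderiv_eq]; exact fderiv_const_apply 0

/-- kit lemma (plumbing) [folklore] -/ theorem curl_C_eq_zero {y : E3} (hy : 2 < ‖y‖ ^ 2) : curl C y = 0 :=
  curl_eq_zero_of_fderiv_eq_zero (fderiv_C_eq_zero hy)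

/-! ### The explicit Leibniz formula for `C` and its two uses (no swirl; axis values) -/

/-- kit lemma (plumbing) [folklore] -/ theorem curlCLM_apply (L : E3 →L[ℝ] E3) : curlCLM L =
    WithLp.toLp 2 ![L (EuclideanSpace.single 1 1) 2 - L (EuclideanSpace.single 2 1) 1,
      L (EuclideanSpace.single 2 1) 0 - L (EuclideanSpace.single 0 1) 2,
      L (EuclideanSpace.single 0 1) 1 - L (EuclideanSpace.single 1 1) 0] := rfl

/-- kit lemma (plumbing) [folklore] -/ theorem C_apply (y : E3) : C y = φC y • Dsh y +
    curlCLM ((deriv hC (‖y‖ ^ 2) • ((2 : ℕ) • innerSL ℝ y)).smulRight (Ad y)) := by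
  show curl (fun z => φC z • Ad z) y = _
  rw [curl_smul (φC_differentiable y) (Ad_differentiable y), curl_Ad, (hasFDerivAt_φC y).fderiv]

/-- NO SWIRL for the cavity: `⟪C y, e_θ(y)⟫ = 0`. -/
theorem inner_C_etheta (y : E3) : ⟪C y, WithLp.toLp 2 ![-y 1, y 0, 0]⟫ = 0 := by
  rw [C_apply, inner_add_left, inner_smul_left, curlCLM_apply, inner_eq3, inner_eq3]
  simp [ContinuousLinearMap.smulRight_apply, EuclideanSpace.inner_single_right, Ad_apply_zero, Ad_apply_one,
    Ad_apply_two]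
  ring

/-- AXIS VALUES of the cavity: `C (0,0,ζ) = hC(ζ²) · (0, 0, −2(ζ+2))`, third component. -/
theorem C_axis_two (ζ : ℝ) :
    C (EuclideanSpace.single 2 ζ) 2 = hC (ζ ^ 2) * (-2 * (ζ + 2)) := by
  have hA : Ad (EuclideanSpace.single 2 ζ) = 0 := by
    ext i; fin_cases i <;> simp [Ad]
  rw [C_apply, hA]
  simp [φC]

end Summit.NavierStokesRegularity.NavierStokesRegularity.Theorems.LucardoOlivaes2026GI

end
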